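import Summits.KontsevichZagierPeriods.KontsevichZagierPeriods.Theses.SymplecticScissors

/-!
# `CurvePeriodsTransfer` (stmt-KontsevichZagierPeriods-11129), line `standard-etale-models` —
# negative side: the ÉTALENESS hypothesis of `stub_etaleShift` is load-bearing

`stub_etaleShift` (skeleton `Cruxes/CurvePeriodsTransfer/Lines/standard-etale-models.lean`) turns a root
branch `g` of `G ∈ ℚ̄[s, y]` that is étale on `(0, ε)` into a branch `u = (g − T)/sᴷ` ending at an ÉTALE point
of the shifted curve `G_K = s^{−e} G(s, T + sᴷ y)`. This file records, as a kernel-checked fact for the lead and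
the planner, that the hypothesis `∀ᶠ s in 𝓝[>] 0, ∂_y G(s, g s) ≠ 0` cannot be dropped: for the double line
`G = y²` and the branch `g = 0` every datum `(K, e, T, G_K, u)` satisfying the two shift identities and
`g = T + sᴷ u` near `0` has `∂_y G_K(0, u 0) = 0` (differentiate the first identity: along the branch the
second identity reads `0 = sᵉ · ∂_y G_K(s, u s)`, so `∂_y G_K(s, u s) = 0` for `s ≠ 0` near `0`, and at `s = 0`
by continuity). So any proof of `stub_etaleShift` must use étaleness of the branch near `0⁺` — which is what
`stub_pieceReduction` delivers on `(0, 1]`. [cite: BochnakCosteRoy1998, §8.1]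
-/

noncomputable section

open scoped Topology
open Filter

namespace Summit.KontsevichZagierPeriods.SymplecticScissors.CurvePeriodsTransferNegative

/-- Coefficients of `y² = X 1 ^ 2 ∈ ℝ[s, y]` are algebraic (they are `0` or `1`). [folklore] -/
theorem isAlgebraic_coeff_X_one_sq (d : Fin 2 →₀ ℕ) :
    IsAlgebraic ℚ ((MvPolynomial.X 1 ^ 2 : MvPolynomial (Fin 2) ℝ).coeff d) := by
  have h : (MvPolynomial.X 1 ^ 2 : MvPolynomial (Fin 2) ℝ) =
      MvPolynomial.map (algebraMap ℚ ℝ) (MvPolynomial.X 1 ^ 2) := by simp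
  rw [h, MvPolynomial.coeff_map]
  exact isAlgebraic_algebraMap _

/-- **The étaleness hypothesis of `stub_etaleShift` is load-bearing**: without it the statement fails for
the double line `G = y²` and the zero branch `g = 0`. [folklore] -/
theorem etaleShift_false_without_etale : ¬ (∀ (g : ℝ → ℝ) (G : MvPolynomial (Fin 2) ℝ), AnalyticAt ℝ g 0 →
    (∀ n, IsAlgebraic ℚ (iteratedDeriv n g 0)) → (∀ d, IsAlgebraic ℚ (G.coeff d)) →
    (∀ᶠ s in 𝓝[>] (0 : ℝ), MvPolynomial.eval ![s, g s] G = 0) →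
    ∃ (K e : ℕ) (T : Polynomial ℝ) (GK : MvPolynomial (Fin 2) ℝ) (u : ℝ → ℝ),
      (∀ i, IsAlgebraic ℚ (T.coeff i)) ∧ (∀ d, IsAlgebraic ℚ (GK.coeff d)) ∧
      (∀ s y : ℝ, MvPolynomial.eval ![s, Polynomial.eval s T + s ^ K * y] G =
        s ^ e * MvPolynomial.eval ![s, y] GK) ∧
      (∀ s y : ℝ, s ^ K * MvPolynomial.eval ![s, Polynomial.eval s T + s ^ K * y] (MvPolynomial.pderiv 1 G) =
        s ^ e * MvPolynomial.eval ![s, y] (MvPolynomial.pderiv 1 GK)) ∧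
      AnalyticAt ℝ u 0 ∧ (∀ᶠ s in 𝓝 (0 : ℝ), g s = Polynomial.eval s T + s ^ K * u s) ∧
      IsAlgebraic ℚ (u 0) ∧ MvPolynomial.eval ![0, u 0] GK = 0 ∧
      MvPolynomial.eval ![0, u 0] (MvPolynomial.pderiv 1 GK) ≠ 0) := by
  intro h
  obtain ⟨K, e, T, GK, u, -, -, -, h2, hu, hg, -, -, hne⟩ :=
    h (fun _ => 0) (MvPolynomial.X 1 ^ 2) analyticAt_const
      (fun n => by
        rcases n with _ | n
        · simpa using isAlgebraic_zero
        · rw [iteratedDeriv_const]; simpa using isAlgebraic_zero)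
      isAlgebraic_coeff_X_one_sq
      (Eventually.of_forall fun s => by simp)
  -- the function `φ s = ∂_y G_K (s, u s)` is continuous at `0` and vanishes on a punctured neighbourhood
  set φ : ℝ → ℝ := fun s => MvPolynomial.eval ![s, u s] (MvPolynomial.pderiv 1 GK) with hφ
  have hφc : ContinuousAt φ 0 := by
    have hv : ContinuousAt (fun s : ℝ => (![s, u s] : Fin 2 → ℝ)) 0 := by
      refine continuousAt_pi.2 fun i => ?_
      fin_cases i
      · exact continuousAt_id
      · exact hu.continuousAt
    exact ((MvPolynomial.continuous_eval _).continuousAt).comp hv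
  -- along the branch, the second identity reads `0 = s ^ e * φ s`
  have hzero : ∀ᶠ s in 𝓝 (0 : ℝ), s ^ e * φ s = 0 := by
    filter_upwards [hg] with s hs
    have := h2 s (u s)
    rw [← hs] at this
    simpa [Derivation.leibniz_pow, MvPolynomial.pderiv_X] using this.symm
  have hpunct : ∀ᶠ s in 𝓝[≠] (0 : ℝ), φ s = 0 := by
    have h' : ∀ᶠ s in 𝓝[≠] (0 : ℝ), s ^ e * φ s = 0 := nhdsWithin_le_nhds hzero
    filter_upwards [h', self_mem_nhdsWithin] with s hs hs0
    exact (mul_eq_zero.mp hs).resolve_left (pow_ne_zero _ hs0)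
  have hlim0 : Tendsto φ (𝓝[≠] (0 : ℝ)) (𝓝 0) :=
    (tendsto_const_nhds (x := (0 : ℝ))).congr' (hpunct.mono fun s hs => hs.symm)
  have hlim : Tendsto φ (𝓝[≠] (0 : ℝ)) (𝓝 (φ 0)) := hφc.tendsto.mono_left nhdsWithin_le_nhds
  have h00 : φ 0 = 0 := tendsto_nhds_unique hlim hlim0
  exact hne h00

end Summit.KontsevichZagierPeriods.SymplecticScissors.CurvePeriodsTransferNegative

end
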